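import Summits.CriticalPhenomena.CardyFormulaZ2.Theorems.CardyIKTransportIKMixedBoxCrossingDefectStubBridgeOfLaw
import Summits.CriticalPhenomena.CardyFormulaZ2.Theorems.CardyIKTransportIKMixedBoxCrossingQuenchedVarianceDefs

/-!
# The `k`-box bridge `μIK ↔ boxLaw ↔ colourLaw` at fixed coins (line `defect-closure-exploration` v8 / ALT line
# `quenched-chain-fkg`, crux `IKMixedBoxCrossing`, stmt-CriticalPhenomena-5911)

Support file (`--supports stmt-CriticalPhenomena-5911`, registered helper stub `quenched_bridge_family`) for the stub
`stub_approxHarrisFamOfVariance` (F) of `…QuenchedVarianceDefs`: STEP 1 of (F).  For `k` box-crossing events whose boxes lie in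
the cell rectangle `Λ₀ = [0, W) × [0, H)`,

  `μIK (∩ᵢ boxEvent S bsᵢ) = ∑_{c ⊆ facesIn S Λ₀} 2^{-|facesIn S Λ₀|} · colourLaw S Λ₀ {boxFill Λ₀ white s | s ∈ ∩ᵢ boxFamily S Λ₀ bsᵢ c}`.

Ingredients: the landed law identity `stub_bridgeLaw` (`μIK.map (gaugeBox S W H) = (boxLaw S Λ₀).map (freeBox W H)`); WEAK BOX
LOCALITY (`cross_congr_weak`): a crossing event of a box reads the colours of the box cells and the anti flags of the faces whose whole
2 × 2 block lies in the box — so on both sides the `k` events are ONE event of the box data, and on the free side, at colouring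
`boxFill Λ₀ white s` and coins `κ`, the event is `s ∈ boxFamily S Λ₀ bs c` with `c` the set of `S`-faces of `Λ₀` where `κ` is true
(faces off the `S`-columns are anti on both sides; an `S`-face read by the event is an inner face of `Λ₀`); and the product structure
`boxLaw = colourLaw ⊗ coinMeasure ½` (`boxLaw_real_eq_sum`: the colour law is carried by the fillings `boxFill Λ₀ white s`, the coin
cylinder of `c` has mass `2^{-|facesIn S Λ₀|}`).  No new definitions.
-/

noncomputable section

namespace Summit.CriticalPhenomena.CardyFormulaZ2.Cruxes.IKMixedBoxCrossing.QuenchedChainFKG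

open scoped Classical BigOperators
open MeasureTheory Finset
open Literature.Probability.Percolation Literature.Probability.LatticeModels
open Summit.CriticalPhenomena.CardyFormulaZ2.Theorems.IKLinearTransport.PinnedDiagramExchange
  (Ω μIK blackSet antiSet Obs obs blackEdges lrCross tbCross)
open Summit.CriticalPhenomena.CardyFormulaZ2.Theorems.IKLinearTransport.PinnedDiagramExchange.CouplingToLimits
  (mk_mem_blackEdges_iff)
open Summit.CriticalPhenomena.CardyFormulaZ2.Cruxes.IKMixedBoxCrossing.PairedMirrorExploration.StubPatternLocality
  (mem_openCrossing_congr)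
open Summit.CriticalPhenomena.CardyFormulaZ2.Cruxes.IKMixedBoxCrossing.DefectClosureExploration
  (facesIn colourLaw boxLaw cellRect antiFaces BoxData gaugeBox freeBox stub_bridgeLaw)
open Summit.CriticalPhenomena.CardyFormulaZ2.Cruxes.IKMixedBoxCrossing.DefectClosureExploration.BridgeLawStub
  (site site_injective exists_site_eq measurable_gaugeBox measurable_freeBox)
open Summit.CriticalPhenomena.CardyFormulaZ2.Cruxes.IKMixedBoxCrossing.DefectClosureExploration.BridgeOfLawStub
  (toObs ofBox site_mem_ofBox_fst site_mem_ofBox_snd gaugeBox_fst gaugeBox_snd mem_cellRect measurable_apply_eq_true)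

namespace BridgeFamily

/-! ## §1 Weak box locality of the crossing events -/

/-- WEAK BOX LOCALITY: observables with the same colours on the cells of the box `[a, a+w) × [b, b+h)` and the same anti
flags on the faces whose 2 × 2 block lies in the box have the same crossings of the box (a diagonal edge of the box reads
the flag of the face spanned by its two endpoints' block, which lies in the box). -/
theorem cross_congr_weak {a b : ℤ} {w h : ℕ} {x y : Obs}
    (h1 : ∀ v : Site 2, a ≤ v 0 → v 0 < a + w → b ≤ v 1 → v 1 < b + h → (v ∈ x.1 ↔ v ∈ y.1))
    (h2 : ∀ f : Site 2, a ≤ f 0 → f 0 + 1 < a + w → b ≤ f 1 → f 1 + 1 < b + h → (f ∈ x.2 ↔ f ∈ y.2)) :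
    (x ∈ lrCross a b w h ↔ y ∈ lrCross a b w h) ∧ (x ∈ tbCross a b w h ↔ y ∈ tbCross a b w h) := by
  have clause : ∀ p q : Site 2, p ∈ {v : Site 2 | a ≤ v 0 ∧ v 0 < a + w ∧ b ≤ v 1 ∧ v 1 < b + h} →
      q ∈ {v : Site 2 | a ≤ v 0 ∧ v 0 < a + w ∧ b ≤ v 1 ∧ v 1 < b + h} →
      ((p ∈ x.1 ∧ q ∈ x.1 ∧ (q = p + ![1, 0] ∨ q = p + ![0, 1] ∨ (q = p + ![1, 1] ∧ ¬ p ∈ x.2) ∨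
          (q = p + ![1, -1] ∧ (p + ![0, -1]) ∈ x.2))) ↔
        (p ∈ y.1 ∧ q ∈ y.1 ∧ (q = p + ![1, 0] ∨ q = p + ![0, 1] ∨ (q = p + ![1, 1] ∧ ¬ p ∈ y.2) ∨
          (q = p + ![1, -1] ∧ (p + ![0, -1]) ∈ y.2)))) := by
    intro p q hp hq
    simp only [Set.mem_setOf_eq] at hp hq
    have hp1 := h1 p hp.1 hp.2.1 hp.2.2.1 hp.2.2.2
    have hq1 := h1 q hq.1 hq.2.1 hq.2.2.1 hq.2.2.2
    have hd1 : q = p + ![1, 1] → (p ∈ x.2 ↔ p ∈ y.2) := fun hqp => by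
      subst hqp
      simp only [Pi.add_apply, Matrix.cons_val_zero, Matrix.cons_val_one, Matrix.cons_val_fin_one] at hq
      exact h2 p hp.1 (by omega) hp.2.2.1 (by omega)
    have hd2 : q = p + ![1, -1] → ((p + ![0, -1]) ∈ x.2 ↔ (p + ![0, -1]) ∈ y.2) := fun hqp => by
      subst hqp
      simp only [Pi.add_apply, Matrix.cons_val_zero, Matrix.cons_val_one, Matrix.cons_val_fin_one] at hq
      refine h2 _ ?_ ?_ ?_ ?_ <;>
        simp only [Pi.add_apply, Matrix.cons_val_zero, Matrix.cons_val_one, Matrix.cons_val_fin_one] <;> omega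
    rw [hp1, hq1]
    exact and_congr_right' (and_congr_right' (or_congr_right (or_congr_right (or_congr
      (and_congr_right fun hq' => not_congr (hd1 hq')) (and_congr_right hd2)))))
  have key : ∀ u ∈ {v : Site 2 | a ≤ v 0 ∧ v 0 < a + w ∧ b ≤ v 1 ∧ v 1 < b + h},
      ∀ v ∈ {v : Site 2 | a ≤ v 0 ∧ v 0 < a + w ∧ b ≤ v 1 ∧ v 1 < b + h},
        (s(u, v) ∈ blackEdges x ↔ s(u, v) ∈ blackEdges y) := fun u hu v hv => by
    rw [mk_mem_blackEdges_iff, mk_mem_blackEdges_iff]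
    exact or_congr (clause u v hu hv) (clause v u hv hu)
  exact ⟨mem_openCrossing_congr key, mem_openCrossing_congr key⟩

/-! ## §2 Boxes inside `[0, W) × [0, H)`: both sides read one event of the box data -/

/-- GAUGE SIDE: the crossings of a box inside `[0, W) × [0, H)` are read from the gauge's box data. -/
theorem obs_cross_iff_ofBox (S : Set ℤ) {W H : ℕ} {a b : ℤ} {w h : ℕ}
    (hin : 0 ≤ a ∧ a + w ≤ W ∧ 0 ≤ b ∧ b + h ≤ H) (ω : Ω) :
    (obs S ω ∈ lrCross a b w h ↔ ofBox S (gaugeBox S W H ω) ∈ lrCross a b w h) ∧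
      (obs S ω ∈ tbCross a b w h ↔ ofBox S (gaugeBox S W H ω) ∈ tbCross a b w h) := by
  refine cross_congr_weak (fun v h0 hw h1 hh => ?_) (fun f h0 hw h1 hh => ?_)
  · obtain ⟨q, rfl⟩ := exists_site_eq (k := W) (l := H) (v := v) (by omega) (by omega) (by omega) (by omega)
    rw [site_mem_ofBox_fst, gaugeBox_fst]
    exact Iff.rfl
  · obtain ⟨q, rfl⟩ := exists_site_eq (k := W) (l := H) (v := f) (by omega) (by omega) (by omega) (by omega)
    rw [site_mem_ofBox_snd, gaugeBox_snd]
    exact Iff.rfl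

/-- FREE SIDE: the crossings of a box inside `[0, W) × [0, H)` are read from the free model's box data. -/
theorem toObs_cross_iff_ofBox (S : Set ℤ) {W H : ℕ} {a b : ℤ} {w h : ℕ}
    (hin : 0 ≤ a ∧ a + w ≤ W ∧ 0 ≤ b ∧ b + h ≤ H) (x : CellConfig) :
    (toObs S x ∈ lrCross a b w h ↔ ofBox S (freeBox W H x) ∈ lrCross a b w h) ∧
      (toObs S x ∈ tbCross a b w h ↔ ofBox S (freeBox W H x) ∈ tbCross a b w h) := by
  refine cross_congr_weak (fun v h0 hw h1 hh => ?_) (fun f h0 hw h1 hh => ?_)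
  · obtain ⟨q, rfl⟩ := exists_site_eq (k := W) (l := H) (v := v) (by omega) (by omega) (by omega) (by omega)
    rw [site_mem_ofBox_fst]
    exact Iff.rfl
  · obtain ⟨q, rfl⟩ := exists_site_eq (k := W) (l := H) (v := f) (by omega) (by omega) (by omega) (by omega)
    rw [site_mem_ofBox_snd]
    exact Iff.rfl

/-- FREE SIDE AT FIXED COINS: at the filling `boxFill Λ white s` and coins `κ`, the crossings of a box whose cells lie in `Λ` are
those of the finite configuration `finObs S s c`, `c` the `S`-faces of `Λ` where `κ` is true (an `S`-face read by the event has
its block in the box, hence is an inner face of `Λ`). -/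
theorem toObs_boxFill_cross_iff (S : Set ℤ) {Λ : Finset (Site 2)} {a b : ℤ} {w h : ℕ}
    (hΛ : ∀ v : Site 2, a ≤ v 0 → v 0 < a + w → b ≤ v 1 → v 1 < b + h → v ∈ Λ)
    (s : Finset (Site 2)) (κ : Site 2 → Bool) :
    (toObs S (boxFill Λ (fun _ => false) s, κ) ∈ lrCross a b w h ↔
        finObs S s ((facesIn S Λ).filter fun f => κ f = true) ∈ lrCross a b w h) ∧
      (toObs S (boxFill Λ (fun _ => false) s, κ) ∈ tbCross a b w h ↔
        finObs S s ((facesIn S Λ).filter fun f => κ f = true) ∈ tbCross a b w h) := by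
  refine cross_congr_weak (fun v h0 hw h1 hh => ?_) (fun f h0 hw h1 hh => ?_)
  · show boxFill Λ (fun _ => false) s v = true ↔ v ∈ (↑s : Set (Site 2))
    rw [boxFill_apply_of_mem _ _ (hΛ v h0 hw h1 hh), decide_eq_true_eq, Finset.mem_coe]
  · show (f 0 ∉ S ∨ κ f = true) ↔ (f 0 ∉ S ∨ f ∈ (facesIn S Λ).filter fun f => κ f = true)
    have hf : f ∈ innerVertices Λ := by
      have h10 : (1 : Fin 2) ≠ 0 := by decide
      have h01 : (0 : Fin 2) ≠ 1 := by decide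
      rw [mem_innerVertices_iff]
      intro c hc
      rcases mem_cellFace_iff.1 hc with rfl | rfl | rfl | rfl <;> refine hΛ _ ?_ ?_ ?_ ?_ <;>
        (try simp only [Pi.add_apply, Pi.one_apply, Pi.single_eq_same, Pi.single_eq_of_ne h10,
          Pi.single_eq_of_ne h01]) <;> omega
    by_cases hS : f 0 ∈ S
    · simp only [hS, not_true_eq_false, false_or, Finset.mem_filter, facesIn, hf, true_and]
    · simp only [hS, not_false_eq_true, true_or]

/-! ## §3 The product structure `boxLaw = colourLaw ⊗ coins`: sections at fixed coins -/

/-- The coin cylinder "true exactly on `c` among the faces of `F`" as a product set. -/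
theorem cyl_eq_pi (F c : Finset (Site 2)) :
    {κ : Site 2 → Bool | ∀ f ∈ F, (κ f = true ↔ f ∈ c)} = Set.pi ↑F fun f => {decide (f ∈ c)} := by
  ext κ
  simp only [Set.mem_setOf_eq, Set.mem_pi, Finset.mem_coe, Set.mem_singleton_iff]
  refine forall₂_congr fun f _ => ?_
  cases κ f <;> simp

/-- The coin cylinder is measurable. -/
theorem measurableSet_cyl (F c : Finset (Site 2)) :
    MeasurableSet {κ : Site 2 → Bool | ∀ f ∈ F, (κ f = true ↔ f ∈ c)} := by
  rw [cyl_eq_pi]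
  exact MeasurableSet.pi F.countable_toSet fun _ _ => MeasurableSet.of_discrete

/-- The coin cylinder has mass `2^{-|F|}` under fair coins. -/
theorem coin_real_cyl (F c : Finset (Site 2)) :
    (coinMeasure half).real {κ : Site 2 → Bool | ∀ f ∈ F, (κ f = true ↔ f ∈ c)} = ((1 : ℝ) / 2) ^ F.card := by
  rw [cyl_eq_pi, coinMeasure, measureReal_def, Measure.infinitePi_pi _ (fun _ _ => MeasurableSet.of_discrete),
    ENNReal.toReal_prod, ← Finset.prod_const]
  refine Finset.prod_congr rfl fun f _ => ?_
  rw [← measureReal_def]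
  cases decide (f ∈ c) <;> norm_num

/-- The coins true among `F` are exactly `c ⊆ F` iff the coin configuration lies in the cylinder of `c`. -/
theorem filter_eq_iff {F c : Finset (Site 2)} (hc : c ⊆ F) (κ : Site 2 → Bool) :
    F.filter (fun f => κ f = true) = c ↔ ∀ f ∈ F, (κ f = true ↔ f ∈ c) := by
  constructor
  · intro h f hf
    rw [← h, Finset.mem_filter]
    exact ⟨fun hk => ⟨hf, hk⟩, fun h' => h'.2⟩
  · intro h
    ext f
    rw [Finset.mem_filter]
    exact ⟨fun h' => (h f h'.1).1 h'.2, fun hfc => ⟨hc hfc, (h f (hc hfc)).2 hfc⟩⟩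

/-- The colour law is carried by the fillings `boxFill Λ white s`, `s ⊆ Λ`. -/
theorem colourLaw_compl_image (S : Set ℤ) (Λ : Finset (Site 2)) :
    colourLaw S Λ ((fun s => boxFill Λ (fun _ => false) s) '' (↑Λ.powerset : Set (Finset (Site 2))))ᶜ = 0 := by
  refine cornerGibbsMeasure_apply_eq_zero_of_forall _ _ _ _ fun σ hσ => ?_
  by_contra h
  push Not at h
  exact hσ ⟨Λ.filter fun x => σ x = true, Finset.mem_coe.2 (Finset.mem_powerset.2 (Finset.filter_subset _ _)),
    (eq_boxFill_of_eqOn h).symm⟩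

/-- SECTION DECOMPOSITION: an event of the free model which, at the filling `boxFill Λ white s` and coins `κ`, only asks
`P s c` of `s` and of the set `c` of `S`-faces of `Λ` where `κ` is true, meets the carrier of the colour law in the disjoint
union over `c` of (fillings with `P · c`) × (coin cylinder of `c`). -/
theorem inter_range_eq_iUnion (S : Set ℤ) (Λ : Finset (Site 2)) (A : Set CellConfig)
    (P : Finset (Site 2) → Finset (Site 2) → Prop) [∀ s c, Decidable (P s c)]
    (hA : ∀ s ⊆ Λ, ∀ κ : Site 2 → Bool,
      ((boxFill Λ (fun _ => false) s, κ) ∈ A ↔ P s ((facesIn S Λ).filter fun f => κ f = true))) :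
    A ∩ ((fun s => boxFill Λ (fun _ => false) s) '' (↑Λ.powerset : Set (Finset (Site 2)))) ×ˢ Set.univ =
      ⋃ c ∈ (facesIn S Λ).powerset,
        ((fun s => boxFill Λ (fun _ => false) s) '' (↑(Λ.powerset.filter fun s => P s c) : Set (Finset (Site 2)))) ×ˢ
          {κ : Site 2 → Bool | ∀ f ∈ facesIn S Λ, (κ f = true ↔ f ∈ c)} := by
  ext x
  simp only [Set.mem_inter_iff, Set.mem_prod, Set.mem_univ, and_true, Set.mem_iUnion, exists_prop, Set.mem_image,
    Finset.mem_coe, Finset.mem_powerset, Finset.mem_filter, Set.mem_setOf_eq]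
  constructor
  · rintro ⟨hxA, s, hs, hsx⟩
    have hx : (boxFill Λ (fun _ => false) s, x.2) = x := Prod.ext hsx rfl
    refine ⟨(facesIn S Λ).filter fun f => x.2 f = true, Finset.filter_subset _ _, ⟨s, ⟨hs, ?_⟩, hsx⟩, fun f hf => ?_⟩
    · exact (hA s hs x.2).1 (by rwa [hx])
    · rw [Finset.mem_filter]
      exact ⟨fun hk => ⟨hf, hk⟩, fun h' => h'.2⟩
  · rintro ⟨c, hc, ⟨s, ⟨hs, hP⟩, hsx⟩, hκ⟩
    have hx : (boxFill Λ (fun _ => false) s, x.2) = x := Prod.ext hsx rfl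
    have hfil : (facesIn S Λ).filter (fun f => x.2 f = true) = c := (filter_eq_iff hc x.2).2 hκ
    refine ⟨?_, s, hs, hsx⟩
    rw [← hx]
    exact (hA s hs x.2).2 (hfil ▸ hP)

/-- THE COIN-BY-COIN FORMULA: the free-model probability of such an event is the fair-coin average over `c ⊆ facesIn S Λ`
of the colour-law probabilities of the fillings with `P · c`. -/
theorem boxLaw_real_eq_sum (S : Set ℤ) (Λ : Finset (Site 2)) (A : Set CellConfig)
    (P : Finset (Site 2) → Finset (Site 2) → Prop) [∀ s c, Decidable (P s c)]
    (hA : ∀ s ⊆ Λ, ∀ κ : Site 2 → Bool,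
      ((boxFill Λ (fun _ => false) s, κ) ∈ A ↔ P s ((facesIn S Λ).filter fun f => κ f = true))) :
    (boxLaw S Λ).real A = ∑ c ∈ (facesIn S Λ).powerset, ((1 : ℝ) / 2) ^ (facesIn S Λ).card *
      (colourLaw S Λ ((fun s => boxFill Λ (fun _ => false) s) '' ↑(Λ.powerset.filter fun s => P s c))).toReal := by
  haveI : IsProbabilityMeasure (colourLaw S Λ) := by unfold colourLaw; infer_instance
  haveI : IsProbabilityMeasure (boxLaw S Λ) := by unfold boxLaw; infer_instance
  have hBall : MeasurableSet ((fun s => boxFill Λ (fun _ => false) s) '' (↑Λ.powerset : Set (Finset (Site 2)))) :=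
    (Set.Finite.image _ (Finset.finite_toSet _)).measurableSet
  have hnull : boxLaw S Λ (A \ ((fun s => boxFill Λ (fun _ => false) s) '' (↑Λ.powerset : Set (Finset (Site 2)))) ×ˢ
      Set.univ) = 0 := by
    refine measure_mono_null (t := ((fun s => boxFill Λ (fun _ => false) s) ''
      (↑Λ.powerset : Set (Finset (Site 2))))ᶜ ×ˢ (Set.univ : Set (Site 2 → Bool))) (fun x hx => ?_) ?_
    · exact ⟨fun h => hx.2 ⟨h, Set.mem_univ _⟩, Set.mem_univ _⟩
    · rw [boxLaw, Measure.prod_prod, colourLaw_compl_image, zero_mul]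
  have h1 : (boxLaw S Λ).real A = (boxLaw S Λ).real
      (A ∩ ((fun s => boxFill Λ (fun _ => false) s) '' (↑Λ.powerset : Set (Finset (Site 2)))) ×ˢ Set.univ) := by
    simp only [measureReal_def]
    rw [← measure_inter_add_sdiff A (hBall.prod MeasurableSet.univ), hnull, add_zero]
  rw [h1, inter_range_eq_iUnion S Λ A P hA, measureReal_biUnion_finset]
  · refine Finset.sum_congr rfl fun c _ => ?_
    rw [boxLaw, measureReal_prod_prod, coin_real_cyl, measureReal_def, mul_comm]
  · intro c hc c' hc' hne
    refine Set.disjoint_prod.2 (Or.inr (Set.disjoint_left.2 fun κ h h' => hne ?_))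
    rw [← (filter_eq_iff (Finset.mem_powerset.1 hc) κ).2 h, (filter_eq_iff (Finset.mem_powerset.1 hc') κ).2 h']
  · intro c _
    exact (Set.Finite.image _ (Finset.finite_toSet _)).measurableSet.prod (measurableSet_cyl _ _)

end BridgeFamily

open BridgeFamily

/-- **Registered helper stub `quenched_bridge_family`** (STEP 1 of (F), the `k`-box bridge at fixed coins): for boxes inside
`Λ₀ = [0, W) × [0, H)`, the `μIK`-probability of the intersection of their crossing events is the fair-coin average over the
anti-coin sets `c ⊆ facesIn S Λ₀` of the colour-law probability of the fillings lying in every `boxFamily S Λ₀ (bs i) c`. -/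
theorem quenched_bridge_family : ∀ (S : Set ℤ) (W H k : ℕ) (bs : Fin k → BoxSpec), (∀ i, (bs i).Inside 0 0 W H) →
    μIK.real (⋂ i, boxEvent S (bs i)) =
      ∑ c ∈ (facesIn S (cellRect 0 0 W H)).powerset, ((1 : ℝ) / 2) ^ (facesIn S (cellRect 0 0 W H)).card *
        (colourLaw S (cellRect 0 0 W H) ((fun s => boxFill (cellRect 0 0 W H) (fun _ => false) s) ''
          ↑((cellRect 0 0 W H).powerset.filter fun s => ∀ i, s ∈ boxFamily S (cellRect 0 0 W H) (bs i) c))).toReal := by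
  intro S W H k bs hin
  have hin' : ∀ i, 0 ≤ (bs i).a ∧ (bs i).a + (bs i).w ≤ W ∧ 0 ≤ (bs i).b ∧ (bs i).b + (bs i).h ≤ H := fun i => by
    obtain ⟨h1, h2, h3, h4⟩ := hin i
    exact ⟨h1, by omega, h3, by omega⟩
  have e1 : (⋂ i, boxEvent S (bs i)) = gaugeBox S W H ⁻¹' {d : BoxData W H | ∀ i, ofBox S d ∈
      (if (bs i).lr then lrCross (bs i).a (bs i).b (bs i).w (bs i).h else tbCross (bs i).a (bs i).b (bs i).w (bs i).h)} := by
    ext ω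
    simp only [Set.mem_iInter, Set.mem_preimage, Set.mem_setOf_eq, boxEvent]
    refine forall_congr' fun i => ?_
    obtain ⟨hl, ht⟩ := obs_cross_iff_ofBox S (hin' i) ω
    split_ifs
    exacts [hl, ht]
  have e2 : freeBox W H ⁻¹' {d : BoxData W H | ∀ i, ofBox S d ∈
      (if (bs i).lr then lrCross (bs i).a (bs i).b (bs i).w (bs i).h else tbCross (bs i).a (bs i).b (bs i).w (bs i).h)} =
      {x | ∀ i, toObs S x ∈
        (if (bs i).lr then lrCross (bs i).a (bs i).b (bs i).w (bs i).h else tbCross (bs i).a (bs i).b (bs i).w (bs i).h)} := by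
    ext x
    simp only [Set.mem_preimage, Set.mem_setOf_eq]
    refine forall_congr' fun i => ?_
    obtain ⟨hl, ht⟩ := toObs_cross_iff_ofBox S (hin' i) x
    split_ifs
    exacts [hl.symm, ht.symm]
  have hg : ∀ G : Set (BoxData W H),
      μIK.real (gaugeBox S W H ⁻¹' G) = (boxLaw S (cellRect 0 0 W H)).real (freeBox W H ⁻¹' G) := fun G => by
    rw [← map_measureReal_apply (measurable_gaugeBox S W H) MeasurableSet.of_discrete, stub_bridgeLaw S W H,
      map_measureReal_apply (measurable_freeBox W H) MeasurableSet.of_discrete]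
  rw [e1, hg, e2]
  refine boxLaw_real_eq_sum S (cellRect 0 0 W H) _ (fun s c => ∀ i, s ∈ boxFamily S (cellRect 0 0 W H) (bs i) c)
    fun s hs κ => ?_
  simp only [Set.mem_setOf_eq]
  refine forall_congr' fun i => ?_
  rw [boxFamily, Finset.mem_filter, and_iff_right (Finset.mem_powerset.2 hs)]
  have hΛ : ∀ v : Site 2, (bs i).a ≤ v 0 → v 0 < (bs i).a + (bs i).w → (bs i).b ≤ v 1 → v 1 < (bs i).b + (bs i).h →
      v ∈ cellRect 0 0 W H := fun v h0 hw h1 hh => by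
    have := hin' i
    exact mem_cellRect.2 ⟨by omega, by omega, by omega, by omega⟩
  obtain ⟨hl, ht⟩ := toObs_boxFill_cross_iff S hΛ s κ
  split_ifs
  exacts [hl, ht]

end Summit.CriticalPhenomena.CardyFormulaZ2.Cruxes.IKMixedBoxCrossing.QuenchedChainFKG

end
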